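import Summits.FinalStateConjecture.FinalStateConjecture.Theses.PhotonSphereChannels
import Summits.FinalStateConjecture.FinalStateConjecture.Theorems.SwallowTheDatumTargetGlue
import Summits.FinalStateConjecture.FinalStateConjecture.Theorems.PhotonSphereChannelsTameCensorshipReduction
import Summits.FinalStateConjecture.FinalStateConjecture.Theorems.TameCensorship.Negative.GenericityAndFails
import Summits.FinalStateConjecture.FinalStateConjecture.Theorems.KerrShieldedDataExist.Negative.BentHeight

/-!
# Line `cures-commute-by-causality` — crux `TameCensorship` (K3 of route PhotonSphereChannels,
# item stmt-FinalStateConjecture-10047): CHECKED SKELETON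

Idea (crux-idea card `cures-commute-by-causality`, ideator 1, triage 3/3 pass): the typed
Christodoulou-genericity asks for ONE jointly smooth admissible curve `F` through the exceptional
datum `d`; `Theorems/TameCensorship/Negative/GenericityAndFails.isChristodoulouGeneric_and_fails`
(Disproof §4) shows that separately generic cures can NOT be conjoined by logic. The lever: put TWO
CLOCKS on one curve — a RECEDING-RADIUS clock (the far cure: sealed, `a = 0`, exact-Schwarzschild
burial of the datum beyond 𝔢-radius `R(c) ≥ Θ(c)`, `R(c) → ∞`, collar discrepancy `≤ Θ(c)⁻¹`) and a SHRINKING TIP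
clock (the near cure: a smooth admissible deformation `G c → d` of the core) — and let DOMAIN OF
DEPENDENCE be the conjunction lemma: every clause of the tame property `Q` of an MGHD of the composed
member `F c = Bury_{R(c),Θ(c)}(G c)` is evaluated either on ESCAPING objects (a late near-zone tube
point / a complete ray's future branch outside `D⁺(ι K)`, `K` the compact sealing set of the burial —
settled by exact-Schwarzschild bookkeeping, whatever the core), on SHIELDED objects (inside `D⁺(ι K)` —
decided by the core and inert to the burial), or on PAST-TYPE charts (tube points outside `J⁺(Σ)`,
Disproof §6). The trichotomy is pure logic (negations), so the glue is
kernel-checked here (`TameCensorship_from`, unfolded form; `TameCensorship_of`, by name); the four registered stubs `stub_*` carry exactly: the one-curve composition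
(`TwoClockFamily`), the far clock's payment (`SealedBurialEscape`), the tip clock's payment
(`TipCure`, the hardest: generic LOCAL censorship of the core + the past component), and the
commutation of the two cures (`BurialInertness`). ONE tree obligation is taken BY NAME:
`Theses.SwallowTheDatum.MGHDExists` (stmt-9937, shared by every route of the summit; = Disproof §3's
existential content). The sealed-burial block below is the hypothesis of
`Theses.SwallowTheDatum.KerrShieldedSettles` (stmt-10054) verbatim with `a = 0` (`T = bentHeight M a`, the
tree def equal to the hard-coded lambda by `rfl`), so a proof of that item discharges the complete-`𝓘⁺`
conjunct of `SealedBurialEscape` at once — but the line does not WAIT for it (10054 also asks for an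
exhaustive `N = 1` decomposition, which K3 does not need).

Composition (all `sorry`-free below):
`TipCure` gives `G, Θ₁`; `BurialInertness G` gives `Θ₂`; `TwoClockFamily G (max Θ₁ Θ₂)` gives `F` (smooth, `F 0 = d`, injective and admissible for `|c₀| < 1`, `F c` a sealed burial of `G c`);
for `c ≠ 0`, `|c₀| < 1` and an MGHD `𝒟` of `F c`: `MGHDExists` (∃-conjunct), `SealedBurialEscape`
(compact `K`; complete `𝓘⁺`, escaping charts and rays), `BurialInertness`
(shielded charts and rays w.r.t. that `K`), `TipCure` (past-type charts); clause (i) by the chart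
trichotomy `shielded ∨ escaping-future ∨ past-type` (antitonicity of `truncLateRegion` in `τ₁` only),
clause (ii) by `r₀ := min`, `C := max` over the ray dichotomy; finally the tree's
`Theorems.PhotonSphereChannels.isChristodoulouGeneric_one_of_local` (p70102) turns the local family
into the typed curve-genericity. `TameCensorship_of` is the crux BY NAME modulo exactly the four `stub_*`.

Disproof.lean (cdisprove workfile `Cruxes/TameCensorship/Disproof.lean`, §1–§7; landed parts
`Theorems/TameCensorship/Negative/{ExistentialContent,GenericityModel,GenericityAndFails}`) — honoured:
§4 (`isChristodoulouGeneric_and_fails`, imported here): no stub is an ∧-closure schema — the ONLY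
existential curve is built by `TwoClockFamily ∘ TipCure` and every other stub is a ∀-statement about
sealed burials; `TipCure` keeps its two conjuncts (local goodness, past goodness) under ONE family `G`
precisely because of §4. §6 (`timeReversal_mem_lorentzGroup`, clause (i) is two-sided in time): the
past-type class is explicit and is paid by `TipCure` (generic third law for the reversed cored datum),
not hidden in burial bookkeeping (triage R2). §3 (`exists_isMaximal_of_tameCensorship`): the
existential content enters only through the named obligation `MGHDExists`. §2/§5: no instance of `Q`
is decidable in the tree, so no stub is checkable against a landed Negative lemma beyond §4; none is
an instance of it. §7: vacuous compact `Σ` are covered uniformly (no case split on `X`).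
No `_false_without_<H>` theorem exists for this crux (cycle-1 verdict: the crux resists).
-/

set_option linter.dupNamespace false

open scoped Manifold ContDiff Topology NNReal ENNReal
open Set Filter Metric TopologicalSpace Literature.Geometry.Lorentzian
-- the crux-pinned bent height `T_{M,a}` of the SwallowTheDatum shielding block, as the tree def (`= literal` by `rfl`)
open Summit.FinalStateConjecture.FinalStateConjecture.Theorems.KerrShieldedDataExist.Negative (bentHeight)

noncomputable section

namespace Summit.FinalStateConjecture.FinalStateConjecture.Cruxes.TameCensorship.CuresCommuteByCausality

/-! ## The tame property of the crux, verbatim (its `fun D => …` body; `abbrev`, so that the parametric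
composition `TameCensorship_from` can conclude the UNFOLDED crux while `TameCensorship_of` concludes it BY NAME) -/

/-- The pointwise property `Q` of `PhotonSphereChannels.TameCensorship`, verbatim: MGHD exists ∧ every MGHD has
complete `𝓘⁺` (sojourn form), no `C²`-convergent late chart on a boosted extremal Kerr background anywhere, and
`C³`-bounded geometry of the ray-theoretic outer region at a uniform scale. `TameCensorship` is, by `rfl`,
`∀ X, IsChristodoulouGeneric (admissibleVacuumData X) (TameProperty X) 1` (`tameCensorship_iff_tameProperty`). -/
abbrev TameProperty (X : Type) [TopologicalSpace X] [ChartedSpace E3 X] [IsManifold (𝓡 3) ∞ X] [T2Space X] [SecondCountableTopology X] [ConnectedSpace X]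
    (D : InitialDataSet (𝓡 3) X) : Prop :=
  (∃ 𝒟 : Literature.Geometry.Lorentzian.VacuumCauchyDevelopment D, 𝒟.IsMaximal) ∧ ∀ 𝒟 : Literature.Geometry.Lorentzian.VacuumCauchyDevelopment D, 𝒟.IsMaximal → _root_.Summit.FinalStateConjecture.HasCompleteNullInfinity 𝒟.toCauchyDevelopment ∧ ((∀ (Λ : Literature.Geometry.Lorentzian.lorentzGroup) (c : Literature.Geometry.Lorentzian.E4) (M a : ℝ), Literature.Geometry.Lorentzian.Kerr.IsExtremal M a → ¬ ∃ (τ₀ : ℝ) (Ψ : (Literature.Geometry.Lorentzian.boostedKerrBackground Λ c M a).domain → 𝒟.carrier), 𝒟.toSpacetime.IsLateChart (Literature.Geometry.Lorentzian.boostedKerrBackground Λ c M a) Set.univ τ₀ Ψ ∧ ∀ R : ℝ, Filter.Tendsto (fun τ => 𝒟.toSpacetime.truncDeviationCk (Literature.Geometry.Lorentzian.boostedKerrBackground Λ c M a) Ψ 2 R τ) Filter.atTop (nhds 0)) ∧ ∀ [𝒟.metric.HasLeviCivita], let outer : Set 𝒟.carrier := 𝒟.metric.causalFuture 𝒟.timeOrientation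 (Set.range 𝒟.embed) ∩ {q | ∃ (p : X) (γ : ℝ → 𝒟.carrier) (dom : Set ℝ), 𝒟.metric.IsNormalisedNullRayFrom 𝒟.timeOrientation 𝒟.embed 𝒟.normal p γ dom ∧ ¬ BddAbove dom ∧ q ∈ 𝒟.metric.chronologicalPast 𝒟.timeOrientation (γ '' (dom ∩ Set.Ici 0))}; ∃ r₀ : ℝ, 0 < r₀ ∧ ∃ Λ : NNReal, ∀ q ∈ outer, let U : TopologicalSpace.Opens Literature.Geometry.Lorentzian.E4 := ⟨Metric.ball (0 : Literature.Geometry.Lorentzian.E4) r₀, Metric.isOpen_ball⟩; ∃ Ψ : U → 𝒟.carrier, 𝒟.toSpacetime.IsLateChart (Literature.Geometry.Lorentzian.Minkowski.backgroundOn U) Set.univ (-r₀) Ψ ∧ (∃ x : U, (x : Literature.Geometry.Lorentzian.E4) = 0 ∧ Ψ x = q) ∧ Literature.Geometry.Lorentzian.supCkENorm (U : Set Literature.Geometry.Lorentzian.E4) 3 (𝒟.toSpacetime.deviationExtend (Literature.Geometry.Lorentzian.Minkowski.backgroundOn U) Ψ) ≤ (Λ : ENNReal) ∧ Literature.Geometry.Lorentzian.supCkENorm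 (U : Set Literature.Geometry.Lorentzian.E4) 0 (𝒟.toSpacetime.deviationExtend (Literature.Geometry.Lorentzian.Minkowski.backgroundOn U) Ψ) ≤ 1 / 2)

/-- Read-back: the crux is the curve-genericity of `TameProperty` (definitional). -/
theorem tameCensorship_iff_tameProperty :
    Summit.FinalStateConjecture.FinalStateConjecture.Theses.PhotonSphereChannels.TameCensorship ↔
      ∀ (X : Type) [TopologicalSpace X] [ChartedSpace E3 X] [IsManifold (𝓡 3) ∞ X] [T2Space X] [SecondCountableTopology X] [ConnectedSpace X],
        InitialDataSet.IsChristodoulouGeneric (admissibleVacuumData X) (TameProperty X) 1 :=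
  Iff.rfl

/-! ## The four stub statements (precise `Prop`s, taken BY NAME as the hypotheses of the composition
`TameCensorship_from`; the REGISTERED stubs are `stub_<Name> : <Name>` below — their whole body is `sorry`) -/

/-- **Stub A · `TwoClockFamily` — the one curve carrying both clocks** (size XL; initial-data gluing;
the receding-radius clock outruns any locally bounded demand of the tip clock).
For a fixed sole asymptotically flat end structure `𝔢` of `X`, an admissible datum `d`, ANY jointly smooth
admissible "near" family `G` through `d` (`G 0 = d`) and ANY depth function `Θ ≥ 1` on the
parameter line that is locally bounded away from `c = 0`: there is a jointly smooth
family `F` with `F 0 = d` which, for `|c₀| < 1`, is injective and admissible, and whose members `F c`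
(`c ≠ 0`) are SEALED BURIALS of `G c` beyond `𝔢`-radius `R ≥ Θ c` with collar discrepancy `≤ (Θ c)⁻¹`:
`F c = G c` (both fundamental forms) off `𝔢.far R`; on the collar `R ≤ ‖y‖ ≤ R'` the chart components
differ by `≤ (Θ c)⁻¹` in `C² × C¹`; and `F c` is the exact bent ingoing Kerr–Schild/Boyer–Lindquist slice of a
Schwarzschild black hole (`a = 0`: the pocket is causally SEALED) outside a compact set, the exact region
containing `𝔢.far R'` — verbatim the shielding block of `Theses.SwallowTheDatum.KerrShieldedSettles` /
`ParametricKerrBurial` (stmt-10054/10052) with `a = 0`. Joint smoothness at `c = 0` is eventual constancy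
on compacts (`R(c) → ∞`; `IsSmoothDataFamily` is local in `(c, x)`, Genericity.lean), injectivity is by
pairwise distinct masses `M(c)`. Intended proof: obstruction-free annular gluing (Czimek–Rodnianski
arXiv:2210.09663; Mao–Oh–Tao 2023) of `G c` at radius `R(c)` to the interior Kerr–Schild slice of a mass
`M(c) ≫ R(c)²` Schwarzschild (collar discrepancy `O(m/R + R²/M²) → 0`), Li–Mei arXiv:2005.01249 §2.2 /
Kehle–Unger arXiv:2304.08455 for the sealed background, smooth parameter dependence, `ε`-reparametrisation
`R(c) = R̄(c) + exp(1/c₀²)`. This is the PARAMETRIC-CORE, SEALED form of SwallowTheDatum's engine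
(stmt-10052, XL, open) and inherits its debts (KID-freeness, DR rates of the bent slice — the slice itself is
certified spacelike: `Theorems/KerrShieldedDataExist/Negative/BentSliceConormal`). WHY IT MIGHT FAIL: joint
`C^∞` in `c` of the gluing solution operator on the FIXED `X` together with exact constraints for every `c`;
`G c` is admissible in its own end chart, not a priori in `𝔢`'s (needs compatibility of sole AF end
structures, Bartnik 1986 §3). -/
def TwoClockFamily : Prop :=
  ∀ [Kerr.Facts] (X : Type) [TopologicalSpace X] [ChartedSpace E3 X] [IsManifold (𝓡 3) ∞ X] [T2Space X] [SecondCountableTopology X] [ConnectedSpace X] (𝔢 : AFEnd X), 𝔢.IsSoleEnd → ∀ d ∈ admissibleVacuumData X, ∀ G : EuclideanSpace ℝ (Fin 1) → InitialDataSet (𝓡 3) X, InitialDataSet.IsSmoothDataFamily 1 G → G 0 = d → (∀ c, G c ∈ admissibleVacuumData X) → ∀ Θ : EuclideanSpace ℝ (Fin 1) → ℝ, (∀ c : EuclideanSpace ℝ (Fin 1), 1 ≤ Θ c) → (∀ s t : ℝ, 0 < s → s ≤ t → ∃ Rb : ℝ, ∀ c : EuclideanSpace ℝ (Fin 1), s ≤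 |c 0| → |c 0| ≤ t → Θ c ≤ Rb) → ∃ F : EuclideanSpace ℝ (Fin 1) → InitialDataSet (𝓡 3) X, InitialDataSet.IsSmoothDataFamily 1 F ∧ F 0 = d ∧ (∀ c c' : EuclideanSpace ℝ (Fin 1), |c 0| < 1 → |c' 0| < 1 → F c = F c' → c = c') ∧ (∀ c : EuclideanSpace ℝ (Fin 1), |c 0| < 1 → F c ∈ admissibleVacuumData X) ∧ ∀ c : EuclideanSpace ℝ (Fin 1), c ≠ 0 → |c 0| < 1 → ∃ R R' : ℝ, Θ c ≤ R ∧ (𝔢.R < R ∧ R ≤ R' ∧ (∀ x : X, x ∉ 𝔢.far R → (F c).h.inner x = (G c).h.inner x ∧ (F c).k x = (G c).k x) ∧ (∀ y : E3, R ≤ ‖y‖ → ‖y‖ ≤ R' → (∀ m ≤ 2, ‖iteratedFDeriv ℝ m (𝔢.hCoeff (F c) - 𝔢.hCoeff (G c)) y‖ ≤ (Θ c)⁻¹) ∧ ∀ m ≤ 1, ‖iteratedFDeriv ℝ m (𝔢.kCoeff (F c) - 𝔢.kCoeff (G c)) y‖ ≤ (Θ c)⁻¹) ∧ (∃ (M a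 r₁ : ℝ) (hM : 0 ≤ M) (T : ℝ → ℝ) (φ : Kerr.slice a r₁ → X) (ψ : Kerr.slice a r₁ → Kerr.region a r₁) (ν : NormalField 𝓘(ℝ, E4) ψ), (a = 0 ∧ 𝔢.far R' ⊆ Set.range φ) ∧ |a| < M ∧ Kerr.rMinus M a < r₁ ∧ r₁ < Kerr.rPlus M a ∧ T = bentHeight M a ∧ IsCompact (Set.range φ)ᶜ ∧ Topology.IsOpenEmbedding φ ∧ ContMDiff 𝓘(ℝ, E3) (𝓡 3) ∞ φ ∧ (∀ y : Kerr.slice a r₁, (ψ y : E4) = E4.ofTimeSpace (T (Kerr.radius a (E4.ofTimeSpace 0 (y : E3)))) (y : E3)) ∧ (Kerr.smoothMetric M a r₁).IsSpacelikeImmersion 𝓘(ℝ, E3) ψ ∧ (Kerr.smoothMetric M a r₁).IsFutureUnitNormal 𝓘(ℝ, E3) ((Kerr.timeOrientation M a r₁ hM).ofLE le_top) ψ ν ∧ (∀ y : Kerr.slice a r₁, pullbackBilin (I := 𝓡 3) (I' := 𝓘(ℝ, E3)) φ (F c).h.inner y = pullbackBilin (I := 𝓘(ℝ, E4)) (I'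 := 𝓘(ℝ, E3)) ψ (Kerr.smoothMetric M a r₁).val y) ∧ (∀ [(Kerr.smoothMetric M a r₁).HasLeviCivita] (y : Kerr.slice a r₁), (pullbackBilin (I := 𝓡 3) (I' := 𝓘(ℝ, E3)) φ (F c).k y).toLinearMap₁₂ = (Kerr.smoothMetric M a r₁).secondFundamentalForm 𝓘(ℝ, E3) ψ ν y)))

/-- **Stub B · `SealedBurialEscape` — the receding clock pays for every ESCAPING object** (size L–XL;
causal geometry of the sealed Schwarzschild burial + a pointwise curvature rigidity; no dynamics of the core).
For an admissible datum `D'` that is exactly the bent `a = 0` Schwarzschild slice outside a compact set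
(the block of Stub A without the collar data), there is a COMPACT `K ⊆ X` (the sealing set: core ∪ collar ∪
the slice annulus of advanced time `v ≤ V`, `V` = the advanced time by which the outgoing null cone of the
junction sphere `r = r₁ < 2M` reaches `r = 0`) such that in every MGHD `𝒟` of `D'`: (𝓘⁺) future null infinity is complete in the
sojourn form (`HasCompleteNullInfinity`; exact-Schwarzschild bookkeeping of normalised rays reaching large radii —
literally the first conjunct of `Theses.SwallowTheDatum.KerrShieldedSettles`, stmt-10054, on the same block);
(i_esc) no late chart modelled on a boosted EXTREMAL Kerr background converging in `C²` on the near-zone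
slabs has, for some `R`, tube points `Ψ(truncLateRegion τ₁ R)` outside `D⁺(ι K)` but inside `J⁺(Σ)` for
every `τ₁` — such points lie in the open exact Schwarzschild region `J⁺(ι(X ∖ K)) ⊆ {v > V}` (sealing:
`v` is non-decreasing on future causal curves and `∂J⁺(ι core) ⊆ {v ≤ V}`), where `Ψ^*g` is a pull-back of
the exact Schwarzschild metric, whose complex quadratic Weyl invariant `48M²/r⁶` is REAL, while the
extremal background's `48M'²/(r' − iM' cos θ')⁶` has non-zero imaginary part off the equator: `C²`-closeness
on an open piece of slab is impossible (cf. `Ideas/shield-split-recollapse` `PolarRigiditySchwarzschild`,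
triage F-rig sweep); (ii_esc) the chronological pasts (within `J⁺(Σ)`) of the future branches of
future-complete normalised null rays NOT contained in `D⁺(ι K)` have `C³`-bounded geometry at every scale
`r ≤ r₀` in Minkowski-ball charts with `C⁰`-deviation `≤ 1/2` — such rays never enter the sealed pocket
(their branch has a point of `{v > V}`), so they run to `𝓘⁺`, along `𝓗⁺` or on the photon sphere, and their
pasts lie in the exact exterior ∪ a compact early region, uniformly `C³`-bounded in regular coordinates;
balls near `Σ` fit because the MGHD is two-sided. Leans on: `Theses.SwallowTheDatum.SubdataDevelopmentsEmbed`
(stmt-10053, exterior ignorance) for "the exact region IS Schwarzschild", Kerr–Schild causal lemmas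
(`KerrHorizonCausality.lean`), `Kerr.bilin`. WHY IT MIGHT FAIL: only as typed-geometry slips — a convergent
tube accumulating ON `Σ ∖ ι K` (two-sided exact neighbourhoods handle it), or the uniform scale near `i⁰`
(flatness gives it); the sealing itself is the checked `a = 0` computation of triage (F-bury). -/
def SealedBurialEscape : Prop :=
  ∀ [Kerr.Facts] (X : Type) [TopologicalSpace X] [ChartedSpace E3 X] [IsManifold (𝓡 3) ∞ X] [T2Space X] [SecondCountableTopology X] [ConnectedSpace X] (𝔢 : AFEnd X), 𝔢.IsSoleEnd → ∀ D' ∈ admissibleVacuumData X, (∃ (M a r₁ : ℝ) (hM : 0 ≤ M) (T : ℝ → ℝ) (φ : Kerr.slice a r₁ → X) (ψ : Kerr.slice a r₁ → Kerr.region a r₁) (ν : NormalField 𝓘(ℝ, E4) ψ), a = 0 ∧ |a| < M ∧ Kerr.rMinus M a < r₁ ∧ r₁ < Kerr.rPlus M a ∧ T = bentHeight M a ∧ IsCompact (Set.range φ)ᶜ ∧ Topology.IsOpenEmbedding φ ∧ ContMDiff 𝓘(ℝ, E3) (𝓡 3) ∞ φ ∧ (∀ y : Kerr.slice a r₁, (ψ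 y : E4) = E4.ofTimeSpace (T (Kerr.radius a (E4.ofTimeSpace 0 (y : E3)))) (y : E3)) ∧ (Kerr.smoothMetric M a r₁).IsSpacelikeImmersion 𝓘(ℝ, E3) ψ ∧ (Kerr.smoothMetric M a r₁).IsFutureUnitNormal 𝓘(ℝ, E3) ((Kerr.timeOrientation M a r₁ hM).ofLE le_top) ψ ν ∧ (∀ y : Kerr.slice a r₁, pullbackBilin (I := 𝓡 3) (I' := 𝓘(ℝ, E3)) φ D'.h.inner y = pullbackBilin (I := 𝓘(ℝ, E4)) (I' := 𝓘(ℝ, E3)) ψ (Kerr.smoothMetric M a r₁).val y) ∧ (∀ [(Kerr.smoothMetric M a r₁).HasLeviCivita] (y : Kerr.slice a r₁), (pullbackBilin (I := 𝓡 3) (I' := 𝓘(ℝ, E3)) φ D'.k y).toLinearMap₁₂ = (Kerr.smoothMetric M a r₁).secondFundamentalForm 𝓘(ℝ, E3) ψ ν y)) → ∃ K : Set X, IsCompact K ∧ ∀ 𝒟 : VacuumCauchyDevelopment D', 𝒟.IsMaximal → (Summit.FinalStateConjecture.HasCompleteNullInfinity 𝒟.toCauchyDevelopment ∧ (∀ (Λ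 : lorentzGroup) (x₀ : E4) (M a : ℝ), Kerr.IsExtremal M a → ¬ ∃ (τ₀ : ℝ) (Ψ : (boostedKerrBackground Λ x₀ M a).domain → 𝒟.carrier), 𝒟.toSpacetime.IsLateChart (boostedKerrBackground Λ x₀ M a) Set.univ τ₀ Ψ ∧ (∀ ρ : ℝ, Tendsto (fun τ ↦ 𝒟.toSpacetime.truncDeviationCk (boostedKerrBackground Λ x₀ M a) Ψ 2 ρ τ) atTop (𝓝 0)) ∧ (∃ ρ : ℝ, ∀ τ₁ : ℝ, ∃ x ∈ (boostedKerrBackground Λ x₀ M a).truncLateRegion τ₁ ρ, Ψ x ∉ 𝒟.metric.futureCauchyDevelopment 𝒟.timeOrientation (𝒟.embed '' K) ∧ Ψ x ∈ 𝒟.metric.causalFuture 𝒟.timeOrientation (Set.range 𝒟.embed))) ∧ ∀ [𝒟.metric.HasLeviCivita], (∃ r₀ : ℝ, 0 < r₀ ∧ ∀ r : ℝ, 0 < r → r ≤ r₀ → ∃ C : ℝ≥0, ∀ q ∈ (𝒟.metric.causalFuture 𝒟.timeOrientation (Set.range 𝒟.embed) ∩ {q | ∃ (p : X) (γ : ℝ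 → 𝒟.carrier) (dom : Set ℝ), 𝒟.metric.IsNormalisedNullRayFrom 𝒟.timeOrientation 𝒟.embed 𝒟.normal p γ dom ∧ ¬ BddAbove dom ∧ ¬ (γ '' (dom ∩ Set.Ici 0) ⊆ 𝒟.metric.futureCauchyDevelopment 𝒟.timeOrientation (𝒟.embed '' K)) ∧ q ∈ 𝒟.metric.chronologicalPast 𝒟.timeOrientation (γ '' (dom ∩ Set.Ici 0))}), let U : Opens E4 := ⟨ball (0 : E4) r, isOpen_ball⟩; ∃ Φ : U → 𝒟.carrier, 𝒟.toSpacetime.IsLateChart (Minkowski.backgroundOn U) Set.univ (-r) Φ ∧ (∃ x : U, (x : E4) = 0 ∧ Φ x = q) ∧ supCkENorm (U : Set E4) 3 (𝒟.toSpacetime.deviationExtend (Minkowski.backgroundOn U) Φ) ≤ (C : ℝ≥0∞) ∧ supCkENorm (U : Set E4) 0 (𝒟.toSpacetime.deviationExtend (Minkowski.backgroundOn U) Φ) ≤ 1 / 2))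

/-- **Stub C · `TipCure` — the shrinking-tip clock: generic LOCAL censorship of the core, and the PAST
component** (size: open-problem; the HARDEST stub, the lead's). Through every admissible `d` passes a
jointly smooth admissible near family `G` (`G 0 = d`; "shrinking tip amplitude": `G c → d` in `C^∞_loc`)
together with a locally bounded burial depth `Θ ≥ 1`, such that for every `c ≠ 0`:
(a) LOCAL GOODNESS of `G c` in its OWN maximal developments: for every compact `K ⊆ X`, no late chart on
a boosted extremal Kerr background converging in `C²` on near-zone slabs has all its late tubes
`Ψ(truncLateRegion τ₁ R)` (every `R`, `τ₁ = τ₁(R)`) inside `D⁺(ι K)`, and the pasts of future branches of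
complete normalised null rays lying inside `D⁺(ι K)` are `C³`-tame at all small scales — i.e. the
interior / baby-universe content of K3 (triage R1), with NO reference to `𝓘⁺` or to the asymptotic region;
(b) PAST GOODNESS UNDER DEEP CONTROLLED BURIAL: every admissible sealed burial `D'` of `G c` beyond radius
`R ≥ Θ c` with collar discrepancy `ε' ≤ (Θ c)⁻¹` has, in every MGHD, no convergent extremal late chart of
PAST TYPE (some tube has points outside `J⁺(Σ)` for every `τ₁`) — Disproof §6 / triage R2: this is the
dynamical third law for the time-REVERSED cored datum (white hole of mass `M` expelling the reversed core),
which no burial controls and only genericity of the core can pay. One family `G` carries (a) and (b)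
because curve-genericity is not closed under ∧ (`isChristodoulouGeneric_and_fails`). Why plausibly true:
both failure sets are conjecturally of positive codimension and LOCAL in the data (extremal formation as a
codimension-one critical phenomenon: Kehle–Unger arXiv:2402.10190, arXiv:2211.15742;
Angelopoulos–Kehle–Unger arXiv:2410.16234), so a generic small deformation of the core exits them, and the
tolerance `(Θ c)⁻¹` can be chosen below the extremality gap of the (stable) good configurations; on `X ≅ ℝ³`
(a) is expected to hold for ALL data (no eternal vacuum bags: closed-universe recollapse, Lin–Wald
doi:10.1103/physrevd.41.2444; `Ideas/shield-split-recollapse` CDM(ℝ³)). Transfer: K3 ⇝ its local generic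
core — EASIER because every clause reading infinity (MGHD existence, complete `𝓘⁺`, escaping remnants,
escaping tameness) has left, and what remains is local in the data and stable under the far cure (Stub D).
WHY IT MIGHT FAIL: (b) quantifies over all admissible collars within tolerance: if vacuum extremal-Kerr
formation from regular data exists (open; conjectured, arXiv:2402.10190), collar fine-tuning inside an
`ε`-ball could re-create a reversed extremal remnant unless `(Θ c)⁻¹` beats the extremality gap uniformly in the
burial depth; (a) fails at a datum with a ROBUST eternal baby universe carrying an extremal remnant or
non-tame ray pasts (then K3 itself fails at that datum). -/
def TipCure : Prop :=
  ∀ [Kerr.Facts] (X : Type) [TopologicalSpace X] [ChartedSpace E3 X] [IsManifold (𝓡 3) ∞ X] [T2Space X] [SecondCountableTopology X] [ConnectedSpace X] (𝔢 : AFEnd X), 𝔢.IsSoleEnd → ∀ d ∈ admissibleVacuumData X, ∃ G : EuclideanSpace ℝ (Fin 1) → InitialDataSet (𝓡 3) X, InitialDataSet.IsSmoothDataFamily 1 G ∧ G 0 = d ∧ (∀ c, G c ∈ admissibleVacuumData X) ∧ ∃ Θ : EuclideanSpace ℝ (Fin 1) → ℝ, (∀ c : EuclideanSpace ℝ (Fin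 1), 1 ≤ Θ c) ∧ (∀ s t : ℝ, 0 < s → s ≤ t → ∃ Rb : ℝ, ∀ c : EuclideanSpace ℝ (Fin 1), s ≤ |c 0| → |c 0| ≤ t → Θ c ≤ Rb) ∧ ∀ c : EuclideanSpace ℝ (Fin 1), c ≠ 0 → (∀ 𝒟 : VacuumCauchyDevelopment (G c), 𝒟.IsMaximal → ∀ K : Set X, IsCompact K → ((∀ (Λ : lorentzGroup) (x₀ : E4) (M a : ℝ), Kerr.IsExtremal M a → ¬ ∃ (τ₀ : ℝ) (Ψ : (boostedKerrBackground Λ x₀ M a).domain → 𝒟.carrier), 𝒟.toSpacetime.IsLateChart (boostedKerrBackground Λ x₀ M a) Set.univ τ₀ Ψ ∧ (∀ ρ : ℝ, Tendsto (fun τ ↦ 𝒟.toSpacetime.truncDeviationCk (boostedKerrBackground Λ x₀ M a) Ψ 2 ρ τ) atTop (𝓝 0)) ∧ (∀ ρ : ℝ, ∃ τ₁ : ℝ, Ψ '' ((boostedKerrBackground Λ x₀ M a).truncLateRegion τ₁ ρ) ⊆ 𝒟.metric.futureCauchyDevelopment 𝒟.timeOrientation (𝒟.embed '' K))) ∧ ∀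 [𝒟.metric.HasLeviCivita], (∃ r₀ : ℝ, 0 < r₀ ∧ ∀ r : ℝ, 0 < r → r ≤ r₀ → ∃ C : ℝ≥0, ∀ q ∈ (𝒟.metric.causalFuture 𝒟.timeOrientation (Set.range 𝒟.embed) ∩ {q | ∃ (p : X) (γ : ℝ → 𝒟.carrier) (dom : Set ℝ), 𝒟.metric.IsNormalisedNullRayFrom 𝒟.timeOrientation 𝒟.embed 𝒟.normal p γ dom ∧ ¬ BddAbove dom ∧ γ '' (dom ∩ Set.Ici 0) ⊆ 𝒟.metric.futureCauchyDevelopment 𝒟.timeOrientation (𝒟.embed '' K) ∧ q ∈ 𝒟.metric.chronologicalPast 𝒟.timeOrientation (γ '' (dom ∩ Set.Ici 0))}), let U : Opens E4 := ⟨ball (0 : E4) r, isOpen_ball⟩; ∃ Φ : U → 𝒟.carrier, 𝒟.toSpacetime.IsLateChart (Minkowski.backgroundOn U) Set.univ (-r) Φ ∧ (∃ x : U, (x : E4) = 0 ∧ Φ x = q) ∧ supCkENorm (U : Set E4) 3 (𝒟.toSpacetime.deviationExtend (Minkowski.backgroundOn U) Φ) ≤ (C : ℝ≥0∞) ∧ supCkENorm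 (U : Set E4) 0 (𝒟.toSpacetime.deviationExtend (Minkowski.backgroundOn U) Φ) ≤ 1 / 2))) ∧ ∀ (D' : InitialDataSet (𝓡 3) X) (R R' ε' : ℝ), Θ c ≤ R → ε' ≤ (Θ c)⁻¹ → (𝔢.R < R ∧ R ≤ R' ∧ (∀ x : X, x ∉ 𝔢.far R → D'.h.inner x = (G c).h.inner x ∧ D'.k x = (G c).k x) ∧ (∀ y : E3, R ≤ ‖y‖ → ‖y‖ ≤ R' → (∀ m ≤ 2, ‖iteratedFDeriv ℝ m (𝔢.hCoeff D' - 𝔢.hCoeff (G c)) y‖ ≤ ε') ∧ ∀ m ≤ 1, ‖iteratedFDeriv ℝ m (𝔢.kCoeff D' - 𝔢.kCoeff (G c)) y‖ ≤ ε') ∧ (∃ (M a r₁ : ℝ) (hM : 0 ≤ M) (T : ℝ → ℝ) (φ : Kerr.slice a r₁ → X) (ψ : Kerr.slice a r₁ → Kerr.region a r₁) (ν : NormalField 𝓘(ℝ, E4) ψ), (a = 0 ∧ 𝔢.far R' ⊆ Set.range φ) ∧ |a| < M ∧ Kerr.rMinus M a < r₁ ∧ r₁ < Kerr.rPlus M a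 ∧ T = bentHeight M a ∧ IsCompact (Set.range φ)ᶜ ∧ Topology.IsOpenEmbedding φ ∧ ContMDiff 𝓘(ℝ, E3) (𝓡 3) ∞ φ ∧ (∀ y : Kerr.slice a r₁, (ψ y : E4) = E4.ofTimeSpace (T (Kerr.radius a (E4.ofTimeSpace 0 (y : E3)))) (y : E3)) ∧ (Kerr.smoothMetric M a r₁).IsSpacelikeImmersion 𝓘(ℝ, E3) ψ ∧ (Kerr.smoothMetric M a r₁).IsFutureUnitNormal 𝓘(ℝ, E3) ((Kerr.timeOrientation M a r₁ hM).ofLE le_top) ψ ν ∧ (∀ y : Kerr.slice a r₁, pullbackBilin (I := 𝓡 3) (I' := 𝓘(ℝ, E3)) φ D'.h.inner y = pullbackBilin (I := 𝓘(ℝ, E4)) (I' := 𝓘(ℝ, E3)) ψ (Kerr.smoothMetric M a r₁).val y) ∧ (∀ [(Kerr.smoothMetric M a r₁).HasLeviCivita] (y : Kerr.slice a r₁), (pullbackBilin (I := 𝓡 3) (I' := 𝓘(ℝ, E3)) φ D'.k y).toLinearMap₁₂ = (Kerr.smoothMetric M a r₁).secondFundamentalForm 𝓘(ℝ, E3) ψ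 ν y))) → D' ∈ admissibleVacuumData X → ∀ 𝒟 : VacuumCauchyDevelopment D', 𝒟.IsMaximal → (∀ (Λ : lorentzGroup) (x₀ : E4) (M a : ℝ), Kerr.IsExtremal M a → ¬ ∃ (τ₀ : ℝ) (Ψ : (boostedKerrBackground Λ x₀ M a).domain → 𝒟.carrier), 𝒟.toSpacetime.IsLateChart (boostedKerrBackground Λ x₀ M a) Set.univ τ₀ Ψ ∧ (∀ ρ : ℝ, Tendsto (fun τ ↦ 𝒟.toSpacetime.truncDeviationCk (boostedKerrBackground Λ x₀ M a) Ψ 2 ρ τ) atTop (𝓝 0)) ∧ (∃ ρ : ℝ, ∀ τ₁ : ℝ, ∃ x ∈ (boostedKerrBackground Λ x₀ M a).truncLateRegion τ₁ ρ, Ψ x ∉ 𝒟.metric.causalFuture 𝒟.timeOrientation (Set.range 𝒟.embed)))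

/-- **Stub D · `BurialInertness` — cures commute by causality** (size L–XL / partly open; domain of
dependence + Cauchy stability over the finite pre-crush window; the card's conjunction lemma made precise,
locally uniform along smooth families). For a jointly smooth admissible family `G` all of whose members
`G c` (`c ≠ 0`) are LOCALLY GOOD in their own MGHDs (Stub C (a)), there is a locally bounded depth `Θ ≥ 1`
such that every admissible sealed burial `D'` of `G c` beyond radius `R ≥ Θ c` with collar discrepancy
`ε' ≤ (Θ c)⁻¹` is SHIELD-GOOD in every MGHD and for every compact `K`: no convergent
extremal late chart with all late tubes inside `D⁺(ι K)`, and `C³`-tameness at all small scales of the pasts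
of complete rays whose future branch lies in `D⁺(ι K)`. Mechanism (onset-radius stratification): a shielded
object of `MGHDD'` decided inside `D⁺(ι B̄_ρ)` with `ρ ≤ R` IS the corresponding object of `MGHD(G c)`
(same data on `X ∖ 𝔢.far R`; sub-data developments embed: `Theses.SwallowTheDatum.SubdataDevelopmentsEmbed`,
stmt-10053) — good by hypothesis; an object of later onset feels only the collar (ε-close to `G c`) and
the interior of a Schwarzschild black hole of mass `M ≫ R` (tidal curvature `O(M⁻²)`) during a finite window
before the crush at `r = 0` terminates every causal curve that is not inside a baby universe already
formed, and goodness (non-extremality `|a| < M` of whatever forms, tameness with slack) is an OPEN condition,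
stable under such perturbations for `Θ⁻¹` below the gap and `R ≥ Θ` beyond the dynamics of `G c` — locally
uniformly on compact `c`-intervals by continuity of the family. This is the precise sense in which the far
cure is inert on the near cure; the converse inertness (the core never disturbs the escaping sector) is
Stub B. WHY IT MIGHT FAIL: a burial could CREATE a bad shielded object by core–collar interaction of
unbounded onset time if the good configurations of `G c` degenerate (gap → 0) as the onset radius grows —
e.g. a member whose own evolution produces ever-later, ever-closer-to-extremal interior black holes; the
stub then needs `Θ c` beyond all of them, which exists only if the gap is eventually monotone. -/
def BurialInertness : Prop :=
  ∀ [Kerr.Facts] (X : Type) [TopologicalSpace X] [ChartedSpace E3 X] [IsManifold (𝓡 3) ∞ X] [T2Space X] [SecondCountableTopology X] [ConnectedSpace X] (𝔢 : AFEnd X), 𝔢.IsSoleEnd → ∀ G : EuclideanSpace ℝ (Fin 1) → InitialDataSet (𝓡 3) X, InitialDataSet.IsSmoothDataFamily 1 G → (∀ c, G c ∈ admissibleVacuumData X) → (∀ c : EuclideanSpace ℝ (Fin 1), c ≠ 0 → (∀ 𝒟 : VacuumCauchyDevelopment (G c), 𝒟.IsMaximal → ∀ K : Set X, IsCompact K →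 ((∀ (Λ : lorentzGroup) (x₀ : E4) (M a : ℝ), Kerr.IsExtremal M a → ¬ ∃ (τ₀ : ℝ) (Ψ : (boostedKerrBackground Λ x₀ M a).domain → 𝒟.carrier), 𝒟.toSpacetime.IsLateChart (boostedKerrBackground Λ x₀ M a) Set.univ τ₀ Ψ ∧ (∀ ρ : ℝ, Tendsto (fun τ ↦ 𝒟.toSpacetime.truncDeviationCk (boostedKerrBackground Λ x₀ M a) Ψ 2 ρ τ) atTop (𝓝 0)) ∧ (∀ ρ : ℝ, ∃ τ₁ : ℝ, Ψ '' ((boostedKerrBackground Λ x₀ M a).truncLateRegion τ₁ ρ) ⊆ 𝒟.metric.futureCauchyDevelopment 𝒟.timeOrientation (𝒟.embed '' K))) ∧ ∀ [𝒟.metric.HasLeviCivita], (∃ r₀ : ℝ, 0 < r₀ ∧ ∀ r : ℝ, 0 < r → r ≤ r₀ → ∃ C : ℝ≥0, ∀ q ∈ (𝒟.metric.causalFuture 𝒟.timeOrientation (Set.range 𝒟.embed) ∩ {q | ∃ (p : X) (γ : ℝ → 𝒟.carrier) (dom : Set ℝ), 𝒟.metric.IsNormalisedNullRayFrom 𝒟.timeOrientation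 𝒟.embed 𝒟.normal p γ dom ∧ ¬ BddAbove dom ∧ γ '' (dom ∩ Set.Ici 0) ⊆ 𝒟.metric.futureCauchyDevelopment 𝒟.timeOrientation (𝒟.embed '' K) ∧ q ∈ 𝒟.metric.chronologicalPast 𝒟.timeOrientation (γ '' (dom ∩ Set.Ici 0))}), let U : Opens E4 := ⟨ball (0 : E4) r, isOpen_ball⟩; ∃ Φ : U → 𝒟.carrier, 𝒟.toSpacetime.IsLateChart (Minkowski.backgroundOn U) Set.univ (-r) Φ ∧ (∃ x : U, (x : E4) = 0 ∧ Φ x = q) ∧ supCkENorm (U : Set E4) 3 (𝒟.toSpacetime.deviationExtend (Minkowski.backgroundOn U) Φ) ≤ (C : ℝ≥0∞) ∧ supCkENorm (U : Set E4) 0 (𝒟.toSpacetime.deviationExtend (Minkowski.backgroundOn U) Φ) ≤ 1 / 2)))) → ∃ Θ : EuclideanSpace ℝ (Fin 1) → ℝ, (∀ c : EuclideanSpace ℝ (Fin 1), 1 ≤ Θ c) ∧ (∀ s t : ℝ, 0 < s → s ≤ t → ∃ Rb : ℝ, ∀ c : EuclideanSpace ℝ (Fin 1), s ≤ |c 0|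 → |c 0| ≤ t → Θ c ≤ Rb) ∧ ∀ c : EuclideanSpace ℝ (Fin 1), c ≠ 0 → ∀ (D' : InitialDataSet (𝓡 3) X) (R R' ε' : ℝ), Θ c ≤ R → ε' ≤ (Θ c)⁻¹ → (𝔢.R < R ∧ R ≤ R' ∧ (∀ x : X, x ∉ 𝔢.far R → D'.h.inner x = (G c).h.inner x ∧ D'.k x = (G c).k x) ∧ (∀ y : E3, R ≤ ‖y‖ → ‖y‖ ≤ R' → (∀ m ≤ 2, ‖iteratedFDeriv ℝ m (𝔢.hCoeff D' - 𝔢.hCoeff (G c)) y‖ ≤ ε') ∧ ∀ m ≤ 1, ‖iteratedFDeriv ℝ m (𝔢.kCoeff D' - 𝔢.kCoeff (G c)) y‖ ≤ ε') ∧ (∃ (M a r₁ : ℝ) (hM : 0 ≤ M) (T : ℝ → ℝ) (φ : Kerr.slice a r₁ → X) (ψ : Kerr.slice a r₁ → Kerr.region a r₁) (ν : NormalField 𝓘(ℝ, E4) ψ), (a = 0 ∧ 𝔢.far R' ⊆ Set.range φ) ∧ |a| < M ∧ Kerr.rMinus M a < r₁ ∧ r₁ < Kerr.rPlus M a ∧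 T = bentHeight M a ∧ IsCompact (Set.range φ)ᶜ ∧ Topology.IsOpenEmbedding φ ∧ ContMDiff 𝓘(ℝ, E3) (𝓡 3) ∞ φ ∧ (∀ y : Kerr.slice a r₁, (ψ y : E4) = E4.ofTimeSpace (T (Kerr.radius a (E4.ofTimeSpace 0 (y : E3)))) (y : E3)) ∧ (Kerr.smoothMetric M a r₁).IsSpacelikeImmersion 𝓘(ℝ, E3) ψ ∧ (Kerr.smoothMetric M a r₁).IsFutureUnitNormal 𝓘(ℝ, E3) ((Kerr.timeOrientation M a r₁ hM).ofLE le_top) ψ ν ∧ (∀ y : Kerr.slice a r₁, pullbackBilin (I := 𝓡 3) (I' := 𝓘(ℝ, E3)) φ D'.h.inner y = pullbackBilin (I := 𝓘(ℝ, E4)) (I' := 𝓘(ℝ, E3)) ψ (Kerr.smoothMetric M a r₁).val y) ∧ (∀ [(Kerr.smoothMetric M a r₁).HasLeviCivita] (y : Kerr.slice a r₁), (pullbackBilin (I := 𝓡 3) (I' := 𝓘(ℝ, E3)) φ D'.k y).toLinearMap₁₂ = (Kerr.smoothMetric M a r₁).secondFundamentalForm 𝓘(ℝ, E3) ψ ν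 y))) → D' ∈ admissibleVacuumData X → ∀ 𝒟 : VacuumCauchyDevelopment D', 𝒟.IsMaximal → ∀ K : Set X, IsCompact K → ((∀ (Λ : lorentzGroup) (x₀ : E4) (M a : ℝ), Kerr.IsExtremal M a → ¬ ∃ (τ₀ : ℝ) (Ψ : (boostedKerrBackground Λ x₀ M a).domain → 𝒟.carrier), 𝒟.toSpacetime.IsLateChart (boostedKerrBackground Λ x₀ M a) Set.univ τ₀ Ψ ∧ (∀ ρ : ℝ, Tendsto (fun τ ↦ 𝒟.toSpacetime.truncDeviationCk (boostedKerrBackground Λ x₀ M a) Ψ 2 ρ τ) atTop (𝓝 0)) ∧ (∀ ρ : ℝ, ∃ τ₁ : ℝ, Ψ '' ((boostedKerrBackground Λ x₀ M a).truncLateRegion τ₁ ρ) ⊆ 𝒟.metric.futureCauchyDevelopment 𝒟.timeOrientation (𝒟.embed '' K))) ∧ ∀ [𝒟.metric.HasLeviCivita], (∃ r₀ : ℝ, 0 < r₀ ∧ ∀ r : ℝ, 0 < r → r ≤ r₀ → ∃ C : ℝ≥0, ∀ q ∈ (𝒟.metric.causalFuture 𝒟.timeOrientation (Set.range 𝒟.embed)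 ∩ {q | ∃ (p : X) (γ : ℝ → 𝒟.carrier) (dom : Set ℝ), 𝒟.metric.IsNormalisedNullRayFrom 𝒟.timeOrientation 𝒟.embed 𝒟.normal p γ dom ∧ ¬ BddAbove dom ∧ γ '' (dom ∩ Set.Ici 0) ⊆ 𝒟.metric.futureCauchyDevelopment 𝒟.timeOrientation (𝒟.embed '' K) ∧ q ∈ 𝒟.metric.chronologicalPast 𝒟.timeOrientation (γ '' (dom ∩ Set.Ici 0))}), let U : Opens E4 := ⟨ball (0 : E4) r, isOpen_ball⟩; ∃ Φ : U → 𝒟.carrier, 𝒟.toSpacetime.IsLateChart (Minkowski.backgroundOn U) Set.univ (-r) Φ ∧ (∃ x : U, (x : E4) = 0 ∧ Φ x = q) ∧ supCkENorm (U : Set E4) 3 (𝒟.toSpacetime.deviationExtend (Minkowski.backgroundOn U) Φ) ≤ (C : ℝ≥0∞) ∧ supCkENorm (U : Set E4) 0 (𝒟.toSpacetime.deviationExtend (Minkowski.backgroundOn U) Φ) ≤ 1 / 2))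

/-! ## Registered stubs (`sorry` lives only here) -/

/-- Registered stub: `TwoClockFamily` (statement = the def above, verbatim). -/
theorem stub_TwoClockFamily : TwoClockFamily := by
  sorry

/-- Registered stub: `SealedBurialEscape` (statement = the def above, verbatim). -/
theorem stub_SealedBurialEscape : SealedBurialEscape := by
  sorry

/-- Registered stub: `TipCure` (statement = the def above, verbatim). -/
theorem stub_TipCure : TipCure := by
  sorry

/-- Registered stub: `BurialInertness` (statement = the def above, verbatim). -/
theorem stub_BurialInertness : BurialInertness := by
  sorry

/-! ## Glue lemmas (sorry-free; elementary) -/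

/-- Truncated late regions `{τ < t*, r ≤ R}` are antitone in `τ` (the only "geometry" the chart
trichotomy of `TameCensorship_of` needs). -/
theorem truncLateRegion_anti {B : ModelBackground} {τ τ' R : ℝ} (h : τ ≤ τ') :
    B.truncLateRegion τ' R ⊆ B.truncLateRegion τ R := fun _ hx ↦ ⟨lt_of_le_of_lt h hx.1, hx.2⟩

/-- Local boundedness away from `c = 0` is preserved by `max` (threshold of the receding clock). -/
theorem locBdd_max {R₁ R₂ : EuclideanSpace ℝ (Fin 1) → ℝ}
    (h₁ : ∀ s t : ℝ, 0 < s → s ≤ t → ∃ Rb : ℝ, ∀ c : EuclideanSpace ℝ (Fin 1),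
      s ≤ |c 0| → |c 0| ≤ t → R₁ c ≤ Rb)
    (h₂ : ∀ s t : ℝ, 0 < s → s ≤ t → ∃ Rb : ℝ, ∀ c : EuclideanSpace ℝ (Fin 1),
      s ≤ |c 0| → |c 0| ≤ t → R₂ c ≤ Rb) :
    ∀ s t : ℝ, 0 < s → s ≤ t → ∃ Rb : ℝ, ∀ c : EuclideanSpace ℝ (Fin 1),
      s ≤ |c 0| → |c 0| ≤ t → (fun c ↦ max (R₁ c) (R₂ c)) c ≤ Rb := by
  intro s t hs hst
  obtain ⟨b₁, hb₁⟩ := h₁ s t hs hst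
  obtain ⟨b₂, hb₂⟩ := h₂ s t hs hst
  exact ⟨max b₁ b₂, fun c hsc hct ↦ max_le_max (hb₁ c hsc hct) (hb₂ c hsc hct)⟩

/-- The inverse of the larger depth is the smaller tolerance (collar discrepancy `≤ (Θ c)⁻¹`). -/
theorem inv_max_le_inv {Θ₁ Θ₂ : EuclideanSpace ℝ (Fin 1) → ℝ}
    (h₁ : ∀ c : EuclideanSpace ℝ (Fin 1), 1 ≤ Θ₁ c) (h₂ : ∀ c : EuclideanSpace ℝ (Fin 1), 1 ≤ Θ₂ c)
    (c : EuclideanSpace ℝ (Fin 1)) :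
    ((fun c ↦ max (Θ₁ c) (Θ₂ c)) c)⁻¹ ≤ (Θ₁ c)⁻¹ ∧ ((fun c ↦ max (Θ₁ c) (Θ₂ c)) c)⁻¹ ≤ (Θ₂ c)⁻¹ :=
  ⟨inv_anti₀ (one_pos.trans_le (h₁ c)) (le_max_left _ _),
    inv_anti₀ (one_pos.trans_le (h₂ c)) (le_max_right _ _)⟩

/-! ## The composition (kernel-checked)

`TameCensorship_from`: the four stub statements BY NAME + the one registered obligation every route of the summit
shares (`Theses.SwallowTheDatum.MGHDExists`, stmt-9937 = Choquet-Bruhat–Geroch; Disproof §3 shows it is load-bearing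
for ANY proof of the crux) give the UNFOLDED crux `∀ X, IsChristodoulouGeneric 𝓓 (TameProperty X) 1`;
`TameCensorship_of` feeds it the registered stubs and concludes the crux BY NAME (the only theorem here that does). -/

/-- **`TameCensorship_from`** — cures commute by causality: the one-curve composition of the receding
(burial) clock and the shrinking (tip) clock, the escaping / shielded / past trichotomy of convergent
extremal charts and the escaping / shielded dichotomy of complete rays, and the tree's local-families
lemma give the (unfolded) crux from the four stub statements and the named obligation `MGHDExists`.
Pure logic below the stubs (`Kerr.Facts` is the tree's `SwallowTheDatum.kerrFacts`). -/
theorem TameCensorship_from (hClock : TwoClockFamily) (hEsc : SealedBurialEscape) (hTip : TipCure)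
    (hInert : BurialInertness)
    (hMGHD : Summit.FinalStateConjecture.FinalStateConjecture.Theses.SwallowTheDatum.MGHDExists)
    (X : Type) [TopologicalSpace X] [ChartedSpace E3 X] [IsManifold (𝓡 3) ∞ X] [T2Space X]
    [SecondCountableTopology X] [ConnectedSpace X] :
    InitialDataSet.IsChristodoulouGeneric (admissibleVacuumData X) (TameProperty X) 1 := by
  haveI : Kerr.Facts :=
    Summit.FinalStateConjecture.FinalStateConjecture.Theorems.SwallowTheDatum.kerrFacts
  refine Summit.FinalStateConjecture.FinalStateConjecture.Theorems.PhotonSphereChannels.isChristodoulouGeneric_one_of_local ?_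
  intro d hd _hnot
  -- a sole asymptotically flat end structure of `X` (from the admissibility of `d`), fixed once
  obtain ⟨-, 𝔢, -, hsole, -⟩ := id hd
  -- the tip clock: near family `G` through `d`, with its burial thresholds
  obtain ⟨G, hG, hG0, hGadm, Θ₁, hΘ₁, hB₁, htip⟩ := hTip X 𝔢 hsole d hd
  -- cures commute: depths beyond which burial is inert on the local goodness of `G c`
  obtain ⟨Θ₂, hΘ₂, hB₂, hinert⟩ := hInert X 𝔢 hsole G hG hGadm (fun c hc ↦ (htip c hc).1)
  -- the receding clock outruns both: ONE curve `F` through `d`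
  obtain ⟨F, hF, hF0, hinj, hadm, hbur⟩ := hClock X 𝔢 hsole d hd G hG hG0 hGadm
    (fun c ↦ max (Θ₁ c) (Θ₂ c)) (fun c ↦ le_max_of_le_left (hΘ₁ c)) (locBdd_max hB₁ hB₂)
  refine ⟨1, F, one_pos, hF, hF0, hinj, hadm, fun c hc hc1 ↦ ?_⟩
  -- the member `F c`, `c ≠ 0`, `|c₀| < 1`: a sealed burial of `G c` beyond both thresholds
  obtain ⟨R, R', hR, hseal⟩ := hbur c hc hc1
  have hadm' : F c ∈ admissibleVacuumData X := hadm c hc1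
  obtain ⟨M, a, r₁, hM, T, φ, ψ, ν, ⟨ha0, -⟩, htail⟩ := hseal.2.2.2.2
  -- the far clock pays for the escaping sector (compact sealing set `K`)
  obtain ⟨K, hK, hesc⟩ := hEsc X 𝔢 hsole (F c) hadm' ⟨M, a, r₁, hM, T, φ, ψ, ν, ha0, htail⟩
  refine ⟨hMGHD X (F c) hadm', fun 𝒟 hmax ↦ ?_⟩
  -- escaping sector incl. complete 𝓘⁺ (sojourn form), from the far clock
  obtain ⟨hcomplete, hnoEsc, htameEsc⟩ := hesc 𝒟 hmax
  -- shielded sector: inertness of the burial on the local goodness of `G c`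
  obtain ⟨hnoSh, htameSh⟩ := hinert c hc (F c) R R' ((fun c ↦ max (Θ₁ c) (Θ₂ c)) c)⁻¹
    (le_trans (le_max_right _ _) hR) (inv_max_le_inv hΘ₁ hΘ₂ c).2 hseal hadm' 𝒟 hmax K hK
  -- past-type charts: the tip clock's second conjunct
  have hnoPast := (htip c hc).2 (F c) R R' ((fun c ↦ max (Θ₁ c) (Θ₂ c)) c)⁻¹
    (le_trans (le_max_left _ _) hR) (inv_max_le_inv hΘ₁ hΘ₂ c).1 hseal hadm' 𝒟 hmax
  refine ⟨hcomplete, ?_, ?_⟩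
  · -- clause (i): a convergent extremal chart is shielded, or escaping-to-the-future, or past-type
    rintro Λ x₀ M' a' hext ⟨τ₀, Ψ, hlate, hconv⟩
    by_cases hsh : ∀ ρ : ℝ, ∃ τ₁ : ℝ,
        Ψ '' ((boostedKerrBackground Λ x₀ M' a').truncLateRegion τ₁ ρ) ⊆
          𝒟.metric.futureCauchyDevelopment 𝒟.timeOrientation (𝒟.embed '' K)
    · exact hnoSh Λ x₀ M' a' hext ⟨τ₀, Ψ, hlate, hconv, hsh⟩
    obtain ⟨ρ, hρ⟩ := not_forall.1 hsh
    by_cases hp : ∃ ρ : ℝ, ∀ τ₁ : ℝ,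
        ∃ x ∈ (boostedKerrBackground Λ x₀ M' a').truncLateRegion τ₁ ρ,
          Ψ x ∉ 𝒟.metric.causalFuture 𝒟.timeOrientation (Set.range 𝒟.embed)
    · exact hnoPast Λ x₀ M' a' hext ⟨τ₀, Ψ, hlate, hconv, hp⟩
    obtain ⟨τ₂, hτ₂⟩ := not_forall.1 (not_exists.1 hp ρ)
    refine hnoEsc Λ x₀ M' a' hext ⟨τ₀, Ψ, hlate, hconv, ρ, fun τ₁ ↦ ?_⟩
    obtain ⟨y, hy, hyD⟩ := Set.not_subset.1 (not_exists.1 hρ (max τ₁ τ₂))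
    obtain ⟨x, hx, rfl⟩ := hy
    refine ⟨x, truncLateRegion_anti (le_max_left τ₁ τ₂) hx, hyD, ?_⟩
    by_contra hxJ
    exact hτ₂ ⟨x, truncLateRegion_anti (le_max_right τ₁ τ₂) hx, hxJ⟩
  · -- clause (ii): escaping rays (far clock) and shielded rays (tip clock via inertness);
    -- one scale `min`, one constant `max`
    intro _instLC
    obtain ⟨s₁, hs₁, h₁⟩ := htameEsc
    obtain ⟨s₂, hs₂, h₂⟩ := htameSh
    have hs : 0 < min s₁ s₂ := lt_min hs₁ hs₂
    obtain ⟨C₁, hC₁⟩ := h₁ (min s₁ s₂) hs (min_le_left _ _)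
    obtain ⟨C₂, hC₂⟩ := h₂ (min s₁ s₂) hs (min_le_right _ _)
    refine ⟨min s₁ s₂, hs, max C₁ C₂, fun q hq ↦ ?_⟩
    obtain ⟨hqJ, p, γ, dom, hray, hnb, hqI⟩ := hq
    by_cases hsel : γ '' (dom ∩ Set.Ici 0) ⊆
        𝒟.metric.futureCauchyDevelopment 𝒟.timeOrientation (𝒟.embed '' K)
    · obtain ⟨Φ, hΦl, hΦc, hΦ3, hΦ0⟩ := hC₂ q ⟨hqJ, p, γ, dom, hray, hnb, hsel, hqI⟩
      exact ⟨Φ, hΦl, hΦc, hΦ3.trans (ENNReal.coe_le_coe.2 (le_max_right _ _)), hΦ0⟩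
    · obtain ⟨Φ, hΦl, hΦc, hΦ3, hΦ0⟩ := hC₁ q ⟨hqJ, p, γ, dom, hray, hnb, hsel, hqI⟩
      exact ⟨Φ, hΦl, hΦc, hΦ3.trans (ENNReal.coe_le_coe.2 (le_max_left _ _)), hΦ0⟩

/-- **`TameCensorship_of` — the skeleton**: the crux `PhotonSphereChannels.TameCensorship` BY NAME, modulo exactly
the four registered stubs `stub_TwoClockFamily`, `stub_SealedBurialEscape`, `stub_TipCure`, `stub_BurialInertness`
(the shared MGHD-existence obligation `MGHDExists`, stmt-9937, stays a hypothesis BY NAME: staffed once for the summit). -/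
theorem TameCensorship_of
    (hMGHD : Summit.FinalStateConjecture.FinalStateConjecture.Theses.SwallowTheDatum.MGHDExists) :
    Summit.FinalStateConjecture.FinalStateConjecture.Theses.PhotonSphereChannels.TameCensorship :=
  fun X _ _ _ _ _ _ ↦
    TameCensorship_from stub_TwoClockFamily stub_SealedBurialEscape stub_TipCure stub_BurialInertness hMGHD X

end Summit.FinalStateConjecture.FinalStateConjecture.Cruxes.TameCensorship.CuresCommuteByCausality

end
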